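import Literature.Geometry.GeometricMeasureTheory.Currents
import Mathlib.Analysis.InnerProductSpace.NormDet
import Mathlib.Analysis.InnerProductSpace.GramSchmidtOrtho

/-!
# Simple `m`-vectors of frames in a common `m`-plane: the determinant rule

For an orthonormal frame `v : Fin m → V` of a real inner product space and an arbitrary frame
`w : Fin m → V` lying in the span of `v`, every `m`-covector sees `w` as `det ⟪vᵢ, wⱼ⟫` times `v`:

* `Covector.apply_eq_det_mul_of_mem_span` : `φ w = det (⟪vᵢ, wⱼ⟫) * φ v`;
* `frameVector_eq_det_smul_of_mem_span` : `frameVector w = det (⟪vᵢ, wⱼ⟫) • frameVector v`;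
* `det_inner_sq_eq_det_gram` : `det (⟪vᵢ, wⱼ⟫) ^ 2 = det (⟪wᵢ, wⱼ⟫)` (the Gram determinant);
* `sq_det_inner_comp_eq_normDet_sq` / `abs_det_inner_comp_eq_normDet` : for `w = L ∘ e` with
  `L : P →L[ℝ] V` and `e` an orthonormal basis of `P`, `|det ⟪vᵢ, L eⱼ⟫| = normDet L`, whence
  `frameVector (L ∘ e) = ± normDet L • frameVector v`
  (`frameVector_comp_eq_normDet_smul_or`).

This is the pointwise linear algebra behind the area formula for currents: the push-forward
integrand `φ (DΓ e₁, …, DΓ eₘ)` equals `J Γ · φ (unit tangent m-vector)` up to orientation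
(Federer, *Geometric Measure Theory*, 1.7.5–1.7.6 with 3.2.1 and 4.1.28).

## References

* H. Federer, *Geometric Measure Theory*, Springer 1969, 1.6.1, 1.7.5, 3.2.1, 4.1.28.
-/

noncomputable section

open scoped InnerProductSpace
open Set Module InnerProductSpace

namespace Literature.Geometry.GeometricMeasureTheory

variable {V : Type*} [NormedAddCommGroup V] [InnerProductSpace ℝ V] {m : ℕ}

/-- **Determinant rule.** For an orthonormal frame `v` and a frame `w` in its span, every
`m`-covector satisfies `φ w = det (⟪vᵢ, wⱼ⟫) * φ v`. [cite: Federer1969, 1.6.1, 1.7.5] -/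
theorem Covector.apply_eq_det_mul_of_mem_span {v w : Fin m → V} (hv : Orthonormal ℝ v)
    (hw : ∀ j, w j ∈ Submodule.span ℝ (Set.range v)) (φ : Covector V m) :
    φ w = (Matrix.of fun i j => ⟪v i, w j⟫_ℝ).det * φ v := by
  classical
  -- an orthonormal basis `a` of `S = span v` from `v`
  set S : Submodule ℝ V := Submodule.span ℝ (Set.range v)
  let a₀ : Basis (Fin m) ℝ S := Basis.span hv.linearIndependent
  have ha₀ : ∀ i, (a₀ i : V) = v i := fun i =>
    congrArg Subtype.val (Basis.span_apply hv.linearIndependent i)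
  have ha₀on : Orthonormal ℝ a₀ := by
    rw [orthonormal_iff_ite] at hv ⊢
    intro i j
    rw [Submodule.coe_inner, ha₀, ha₀]
    exact hv i j
  let a : OrthonormalBasis (Fin m) ℝ S := a₀.toOrthonormalBasis ha₀on
  have ha : ∀ i, (a i : V) = v i := fun i => by
    change ((a₀.toOrthonormalBasis ha₀on) i : V) = v i
    rw [Basis.coe_toOrthonormalBasis, ha₀]
  let w' : Fin m → S := fun j => ⟨w j, hw j⟩
  let ψ : S [⋀^Fin m]→ₗ[ℝ] ℝ := φ.toAlternatingMap.compLinearMap S.subtype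
  have h1 := AlternatingMap.eq_smul_basis_det a.toBasis ψ
  have h2 := congrArg (fun f : S [⋀^Fin m]→ₗ[ℝ] ℝ => f w') h1
  simp only [AlternatingMap.smul_apply, smul_eq_mul] at h2
  have e1 : ψ w' = φ w := rfl
  have e2 : ψ (⇑a.toBasis) = φ v := by
    change φ (fun i => S.subtype (a.toBasis i)) = φ v
    congr 1
    funext i
    rw [OrthonormalBasis.coe_toBasis]
    exact ha i
  have e3 : a.toBasis.det w' = (Matrix.of fun i j => ⟪v i, w j⟫_ℝ).det := by
    rw [Basis.det_apply]
    congr 1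
    ext i j
    rw [Basis.toMatrix_apply, OrthonormalBasis.coe_toBasis_repr_apply,
      OrthonormalBasis.repr_apply_apply, Matrix.of_apply, Submodule.coe_inner, ha]
  rw [← e1, h2, e2, e3, mul_comm]

/-- **Determinant rule for simple `m`-vectors**: `w₁ ∧ ⋯ ∧ wₘ = det (⟪vᵢ, wⱼ⟫) · v₁ ∧ ⋯ ∧ vₘ` for
`v` orthonormal and `w` in its span. [cite: Federer1969, 1.6.1] -/
theorem frameVector_eq_det_smul_of_mem_span {v w : Fin m → V} (hv : Orthonormal ℝ v)
    (hw : ∀ j, w j ∈ Submodule.span ℝ (Set.range v)) :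
    frameVector w = (Matrix.of fun i j => ⟪v i, w j⟫_ℝ).det • frameVector v := by
  ext φ
  simp [frameVector_apply, Covector.apply_eq_det_mul_of_mem_span hv hw φ]

/-- Orthonormal expansion inside the span: `⟪wᵢ, wⱼ⟫ = ∑ₖ ⟪vₖ, wᵢ⟫ ⟪vₖ, wⱼ⟫`. [folklore] -/
theorem inner_eq_sum_inner_mul_inner_of_mem_span {v : Fin m → V} (hv : Orthonormal ℝ v) {x y : V}
    (hx : x ∈ Submodule.span ℝ (Set.range v)) :
    ⟪x, y⟫_ℝ = ∑ k, ⟪v k, x⟫_ℝ * ⟪v k, y⟫_ℝ := by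
  classical
  set S : Submodule ℝ V := Submodule.span ℝ (Set.range v)
  let a₀ : Basis (Fin m) ℝ S := Basis.span hv.linearIndependent
  have ha₀ : ∀ i, (a₀ i : V) = v i := fun i =>
    congrArg Subtype.val (Basis.span_apply hv.linearIndependent i)
  have ha₀on : Orthonormal ℝ a₀ := by
    rw [orthonormal_iff_ite] at hv ⊢
    intro i j
    rw [Submodule.coe_inner, ha₀, ha₀]
    exact hv i j
  let a : OrthonormalBasis (Fin m) ℝ S := a₀.toOrthonormalBasis ha₀on
  have ha : ∀ i, (a i : V) = v i := fun i => by
    change ((a₀.toOrthonormalBasis ha₀on) i : V) = v i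
    rw [Basis.coe_toOrthonormalBasis, ha₀]
  -- expand `x = ∑ ⟪v k, x⟫ v k`
  have hx' : x = ∑ k, ⟪v k, x⟫_ℝ • v k := by
    have := a.sum_repr (⟨x, hx⟩ : S)
    have h := congrArg Subtype.val this
    simp only [Submodule.coe_sum, Submodule.coe_smul, OrthonormalBasis.repr_apply_apply,
      Submodule.coe_inner, ha] at h
    exact h.symm
  conv_lhs => rw [hx']
  rw [sum_inner]
  refine Finset.sum_congr rfl fun k _ => ?_
  rw [real_inner_smul_left]

/-- `det (⟪vᵢ, wⱼ⟫)² = det (⟪wᵢ, wⱼ⟫)`: the square of the coefficient determinant is the Gram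
determinant. [cite: Federer1969, 1.7.5] -/
theorem det_inner_sq_eq_det_gram {v w : Fin m → V} (hv : Orthonormal ℝ v)
    (hw : ∀ j, w j ∈ Submodule.span ℝ (Set.range v)) :
    (Matrix.of fun i j => ⟪v i, w j⟫_ℝ).det ^ 2 = (Matrix.of fun i j => ⟪w i, w j⟫_ℝ).det := by
  set M : Matrix (Fin m) (Fin m) ℝ := Matrix.of fun i j => ⟪v i, w j⟫_ℝ
  have hG : (Matrix.of fun i j => ⟪w i, w j⟫_ℝ) = M.transpose * M := by
    ext i j
    rw [Matrix.of_apply, Matrix.mul_apply, inner_eq_sum_inner_mul_inner_of_mem_span hv (hw i)]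
    rfl
  rw [hG, Matrix.det_mul, Matrix.det_transpose, sq]

variable {P : Type*} [NormedAddCommGroup P] [InnerProductSpace ℝ P] [FiniteDimensional ℝ P]

/-- For `w = L ∘ e` (`e` an orthonormal basis of `P`): `det (⟪vᵢ, L eⱼ⟫)² = (normDet L)²`.
[cite: Federer1969, 1.7.5–1.7.6, 3.2.1] -/
theorem sq_det_inner_comp_eq_normDet_sq {v : Fin m → V} (hv : Orthonormal ℝ v)
    (L : P →L[ℝ] V) (e : OrthonormalBasis (Fin m) ℝ P)
    (hw : ∀ j, L (e j) ∈ Submodule.span ℝ (Set.range v)) :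
    (Matrix.of fun i j => ⟪v i, L (e j)⟫_ℝ).det ^ 2 = (L : P →ₗ[ℝ] V).normDet ^ 2 := by
  classical
  rw [det_inner_sq_eq_det_gram hv (w := fun j => L (e j)) hw]
  have h := (L : P →ₗ[ℝ] V).normDet_sq_eq_det_gram e
  rw [RCLike.ofReal_real_eq_id, id_eq] at h
  rw [h]
  rfl

/-- `|det (⟪vᵢ, L eⱼ⟫)| = normDet L`. [cite: Federer1969, 1.7.5–1.7.6, 3.2.1] -/
theorem abs_det_inner_comp_eq_normDet {v : Fin m → V} (hv : Orthonormal ℝ v)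
    (L : P →L[ℝ] V) (e : OrthonormalBasis (Fin m) ℝ P)
    (hw : ∀ j, L (e j) ∈ Submodule.span ℝ (Set.range v)) :
    |(Matrix.of fun i j => ⟪v i, L (e j)⟫_ℝ).det| = (L : P →ₗ[ℝ] V).normDet := by
  have h := sq_det_inner_comp_eq_normDet_sq hv L e hw
  have hn : 0 ≤ (L : P →ₗ[ℝ] V).normDet := LinearMap.normDet_nonneg _
  rw [← Real.sqrt_sq_eq_abs, h, Real.sqrt_sq hn]

/-- **Jacobian rule for simple vectors**: `L e₁ ∧ ⋯ ∧ L eₘ = ± normDet L · v₁ ∧ ⋯ ∧ vₘ` for any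
orthonormal frame `v` spanning a plane containing `range L`. [cite: Federer1969, 1.7.6, 3.2.1, 4.1.28] -/
theorem frameVector_comp_eq_normDet_smul_or {v : Fin m → V} (hv : Orthonormal ℝ v)
    (L : P →L[ℝ] V) (e : OrthonormalBasis (Fin m) ℝ P)
    (hw : ∀ j, L (e j) ∈ Submodule.span ℝ (Set.range v)) :
    frameVector (fun j => L (e j)) = (L : P →ₗ[ℝ] V).normDet • frameVector v ∨
      frameVector (fun j => L (e j)) = -((L : P →ₗ[ℝ] V).normDet • frameVector v) := by
  have h1 := frameVector_eq_det_smul_of_mem_span hv (w := fun j => L (e j)) hw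
  have h2 := abs_det_inner_comp_eq_normDet hv L e hw
  rcases abs_choice ((Matrix.of fun i j => ⟪v i, L (e j)⟫_ℝ).det) with h | h
  · left
    rw [h1, ← h2, h]
  · right
    have hd : (L : P →ₗ[ℝ] V).normDet = -(Matrix.of fun i j => ⟪v i, L (e j)⟫_ℝ).det := by
      rw [← h2, h]
    rw [h1, hd]
    ext φ
    simp

/-! ### The Gram–Schmidt frame is positively oriented -/

omit [FiniteDimensional ℝ P] in
/-- `⟪gramSchmidt w i, w i⟫ = ‖gramSchmidt w i‖ ^ 2`. [folklore] -/
theorem inner_gramSchmidt_self_eq_sq (w : Fin m → V) (i : Fin m) :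
    ⟪gramSchmidt ℝ w i, w i⟫_ℝ = ‖gramSchmidt ℝ w i‖ ^ 2 := by
  conv_lhs => rw [gramSchmidt_def'' ℝ w i]
  rw [inner_add_right, real_inner_self_eq_norm_sq, inner_sum, add_eq_left]
  refine Finset.sum_eq_zero fun k hk => ?_
  rw [real_inner_smul_right, gramSchmidt_orthogonal ℝ w (Finset.mem_Iio.1 hk).ne', mul_zero]

omit [FiniteDimensional ℝ P] in
/-- The coefficient matrix of `w` in its Gram–Schmidt frame is upper triangular with determinant
`∏ ‖gramSchmidt w i‖`. [folklore] -/
theorem det_inner_gramSchmidtNormed_eq_prod {w : Fin m → V} (hw : LinearIndependent ℝ w) :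
    (Matrix.of fun i j => ⟪gramSchmidtNormed ℝ w i, w j⟫_ℝ).det = ∏ i, ‖gramSchmidt ℝ w i‖ := by
  have htri : (Matrix.of fun i j => ⟪gramSchmidtNormed ℝ w i, w j⟫_ℝ).BlockTriangular id := by
    intro i j hij
    rw [Matrix.of_apply, gramSchmidtNormed, real_inner_smul_left,
      gramSchmidt_inv_triangular ℝ w (show j < i from hij), mul_zero]
  rw [Matrix.det_of_upperTriangular htri]
  refine Finset.prod_congr rfl fun i _ => ?_
  have hne : ‖gramSchmidt ℝ w i‖ ≠ 0 := norm_ne_zero_iff.2 (gramSchmidt_ne_zero i hw)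
  rw [Matrix.of_apply, gramSchmidtNormed, real_inner_smul_left, inner_gramSchmidt_self_eq_sq,
    RCLike.ofReal_real_eq_id, id_eq]
  field_simp

omit [FiniteDimensional ℝ P] in
/-- The coefficient determinant of `w` in its Gram–Schmidt frame is positive. [folklore] -/
theorem det_inner_gramSchmidtNormed_pos {w : Fin m → V} (hw : LinearIndependent ℝ w) :
    0 < (Matrix.of fun i j => ⟪gramSchmidtNormed ℝ w i, w j⟫_ℝ).det := by
  rw [det_inner_gramSchmidtNormed_eq_prod hw]
  exact Finset.prod_pos fun i _ => norm_pos_iff.2 (gramSchmidt_ne_zero i hw)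

omit [FiniteDimensional ℝ P] in
/-- Every `w j` lies in the span of the Gram–Schmidt frame of `w`. [folklore] -/
theorem mem_span_gramSchmidtNormed (w : Fin m → V) (j : Fin m) :
    w j ∈ Submodule.span ℝ (Set.range (gramSchmidtNormed ℝ w)) := by
  rw [span_gramSchmidtNormed_range, span_gramSchmidt]
  exact Submodule.subset_span (Set.mem_range_self j)

/-- **Jacobian rule, oriented form**: `L e₁ ∧ ⋯ ∧ L eₘ = normDet L · u₁ ∧ ⋯ ∧ uₘ` where `u` is the
Gram–Schmidt orthonormalisation of `(L eⱼ)` and `L` is injective.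
[cite: Federer1969, 1.7.6, 3.2.1, 4.1.28] -/
theorem frameVector_comp_eq_normDet_smul_gramSchmidtNormed {L : P →L[ℝ] V}
    (hL : Function.Injective L) (e : OrthonormalBasis (Fin m) ℝ P) :
    frameVector (fun j => L (e j)) =
      (L : P →ₗ[ℝ] V).normDet • frameVector (gramSchmidtNormed ℝ fun j => L (e j)) := by
  have hw : LinearIndependent ℝ fun j => L (e j) := by
    have h := e.toBasis.linearIndependent.map' (L : P →ₗ[ℝ] V) (LinearMap.ker_eq_bot.2 hL)
    have hfun : (fun j => L (e j)) = ⇑(L : P →ₗ[ℝ] V) ∘ ⇑e.toBasis := by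
      funext j
      simp
    rw [hfun]
    exact h
  have hv : Orthonormal ℝ (gramSchmidtNormed ℝ fun j => L (e j)) := gramSchmidtNormed_orthonormal hw
  have hmem := mem_span_gramSchmidtNormed (fun j => L (e j))
  have h1 := frameVector_eq_det_smul_of_mem_span hv hmem
  have h2 := abs_det_inner_comp_eq_normDet hv L e hmem
  rw [abs_of_pos (det_inner_gramSchmidtNormed_pos hw)] at h2
  rw [h1, h2]

/-- The same for an arbitrary linearly independent frame `w`: `w₁ ∧ ⋯ ∧ wₘ = c · u₁ ∧ ⋯ ∧ uₘ` with
`c = ∏ ‖gramSchmidt w i‖ > 0` and `u` the Gram–Schmidt frame. [folklore] -/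
theorem frameVector_eq_prod_smul_gramSchmidtNormed {w : Fin m → V} (hw : LinearIndependent ℝ w) :
    frameVector w = (∏ i, ‖gramSchmidt ℝ w i‖) • frameVector (gramSchmidtNormed ℝ w) := by
  rw [← det_inner_gramSchmidtNormed_eq_prod hw]
  exact frameVector_eq_det_smul_of_mem_span (gramSchmidtNormed_orthonormal hw)
    (mem_span_gramSchmidtNormed w)

end Literature.Geometry.GeometricMeasureTheory
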